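import Mathlib
import HarnessLib
import Summits.HubbardSuperconductivity.HubbardSuperconductivity.Theorems.KLProgrammeKLRegimeEngineScaleZeroValues
import Summits.HubbardSuperconductivity.HubbardSuperconductivity.Theorems.KLProgrammeKLRegimeEngineScaleZeroValuesDefs
import Summits.HubbardSuperconductivity.HubbardSuperconductivity.Theorems.KLProgrammeKLRegimeEngineFramePosKernelPieces
import Summits.HubbardSuperconductivity.HubbardSuperconductivity.Theorems.KLProgrammeKLRegimeEngineScaleZeroDecay
import Summits.HubbardSuperconductivity.HubbardSuperconductivity.Theorems.KLProgrammeKLRegimeEngineScaleZeroNormsL1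
import Summits.HubbardSuperconductivity.HubbardSuperconductivity.Theorems.KLProgrammeSalmhoferCutoffSecondDerivBound

/-!
# K3 ENGINE child (stmt-HubbardSuperconductivity-19855 `KLRegimeEngineV12`), stub `stub_engine_scale0`, the VALUES clause at scale `0`,
# EXPLICIT: `‖𝒞₀(Q; k, k′) − U‖ ≤ klScaleZeroValC R · U²` for every admissible frame, once `klScaleZeroThetaC R · U ≤ 1/2`

Cell gate-hubbard-kl, seat p3 (g6).  The step data of `norm_klPairAmplitude_zero_sub_le_of_frameOK` (`…EngineScaleZeroValues`, p487611)
discharged from the tree: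

* the Gram constant: `isGramBoundedR_scaleZero_of_frameOK_sharp` (k3c4-p1; `κ₀ = ρ = √(2(7+6047))`, inside `…_of_frameOK`);
* the decay constant `α = (N/β)·klScaleZeroA0`: k3c4-p2's `alpha_scaleZero_le` (rows; the column twin `alpha_scaleZero_col_le` is proved here
  from `colSum_scaleZero_of_frameOK` by the same algebra) at the tree's profile bounds `B₁ = 32/3` (`klcd_abs_deriv_salmhoferCutoff_le_sharp`),
  `B₂ = 1110` (`klsd_abs_deriv2_salmhoferCutoff_lt`), under `klBetaMin ≤ β`, `β³ ≤ M`;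
* the degree-`2` size `N₁ = (β/N)·Σ_z‖Ǩ_L(z)‖ ≤ (β/N)·klKappaFrameC R·|U|`: `HubbardGridCounterQuadraticL1.sum_norm_kernel_hubbardGridCounterQuadratic_le_l1`
  (k3c2-p1) + `sum_norm_framePosKernel_le_linear_of_frameOK` (`…EngineFramePosKernelPieces`, p3 g6 — `O(|U|)` UNIFORMLY in the number of scales);
* hence `(N/β)·‖Ṽ‖_h ≤ klScaleZeroCV R·U`, `θ ≤ klScaleZeroThetaC R·U`, and with `klScaleZeroThetaC R·U ≤ 1/2` (`θ ≤ 1/2`, `1/(1−θ) ≤ 2`):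

  **`norm_klPairAmplitude_zero_sub_le_sq`**: `‖klPairAmplitude … 0 Qm k k′ − U‖ ≤ klScaleZeroValC R · U²` for EVERY `Qm, k, k′`
  (`FrameOK R U N μ K`, `R.WF`, `0 < U ≤ 1`, `klBetaMin ≤ β ≤ L`, `β³ ≤ M`).

* **`pairLadderStepAtV8_zero_of_frameOK_explicit`** — the registered clause shapes `PairLadderStepAtV8 … 0 ∧ QuarticValueUVAtS2 … 0` for any
  packages `G, P, Q` with `G.WF`, `1 ≤ P.Klam`, `0 ≤ Q.CR` and the NUMBER condition `klScaleZeroValC R ≤ 4·Q.CR·P.Klam²`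
  (`4·Q.CR·(Klam U)² ≤ legDressBarQ G P Q U 0 4`, `0 ≤ initDevBar G U`);
* `pairLadderStepAtV8_zero_of_klEng` — the same under the ENGINE's binders (`klEngL₃ β U ≤ L`, `klEngM₃ β U L ≤ M` give `β ≤ L`, `β³ ≤ M`:
  `le_of_klEngL₃_le`, `pow_three_le_of_klEng`), leaving exactly the two package conditions `klScaleZeroThetaC R·U ≤ 1/2` and
  `klScaleZeroValC R ≤ 4·Q.CR·P.Klam²` — what `stub_engine_scale0`'s assembler checks against `klEngU₀4`/`klEngQ4`.

Everything is proved; no definitions (the constants are `…ScaleZeroValuesDefs`), no named facts, no sorry.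
-/

noncomputable section

namespace Summit.HubbardSuperconductivity.HubbardSuperconductivity.Theorems.EngineV8

set_option linter.dupNamespace false -- summit = problem name (single-conjunct summit), D-0017

open Real Finset Literature.MathematicalPhysics.QuantumLattice Literature.Probability.LatticeModels
open Literature.MathematicalPhysics.QuantumLattice.GrassmannAlgebra
open Summit.HubbardSuperconductivity.HubbardSuperconductivity.Theorems.KLRegimeSplit
open Summit.HubbardSuperconductivity.HubbardSuperconductivity.Theorems.ScaleZeroDecay

/-! ## §1 The column twin of `alpha_scaleZero_le` and the numeric profile bounds -/

section Alpha

variable {R : RenConsts} {U : ℝ} {Nsc : ℕ} {μ : ℝ} {K : TrigPolyC4v} {β : ℝ} {B₁ B₂ : ℝ} {L M : ℕ} [NeZero L]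

/-- **Column sums**: `(β/(2(2M)))·Σ_X ‖(Sᵀ C^K_{>e₀} S) X Y‖ ≤ A₀(B₁, B₂)` — the proof of k3c4-p2's `alpha_scaleZero_le` read on
`colSum_scaleZero_of_frameOK` (same radicand). -/
theorem alpha_scaleZero_col_le (hK : FrameOK R U Nsc μ K) (hβ : klBetaMin ≤ β)
    (hB₁ : ∀ x, |deriv salmhoferCutoff x| ≤ B₁) (hB₂ : ∀ x, |deriv (deriv salmhoferCutoff) x| ≤ B₂) (hβM : β ^ 3 ≤ (M : ℝ))
    (Y : GridLeg (GridPoint L (2 * (2 * M)))) :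
    β / (((2 * (2 * M) : ℕ) : ℝ)) * ∑ X : GridLeg (GridPoint L (2 * (2 * M))),
        ‖((hubbardGridSub L M β (2 * (2 * M))).transpose * hubbardCovAboveCT L M β μ 0 K klE0 *
            hubbardGridSub L M β (2 * (2 * M))) X Y‖ ≤
      14 * Real.sqrt ((1 / 2 + 12 / klE0) *
        (2 / klE0 + 128 * Real.pi ^ 4 * (4 * B₂ + 6 * B₁ + 2) ^ 2 / klE0 + 2 * Real.pi ^ 5 * (4 * B₂ + 6 * B₁ + 2) ^ 2 / klE0 ^ 2 + 1 +
          Real.pi ^ 4 * ((7 : ℝ) ^ 2 * (4 * B₂ + 6 * B₁ + 2) * (2 / klE0) + 7 * (2 * B₁ + 1)) ^ 2 / klE0 ^ 3)) := by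
  have hβ0 : 0 < β := beta_pos_of_klBetaMin_le hβ
  have hβ128 : (128 : ℝ) ≤ β := by simpa [klBetaMin] using hβ
  have hΛ : (0 : ℝ) < klE0 := by norm_num [klE0]
  have hL : (0 : ℝ) < L := by exact_mod_cast Nat.pos_of_ne_zero (NeZero.ne L)
  have hβ3 : β ≤ β ^ 3 := by nlinarith [sq_nonneg β]
  have hMr : β ≤ (M : ℝ) := hβ3.trans hβM
  have hM2 : 2 ≤ M := by
    have : (2 : ℝ) ≤ M := by linarith
    exact_mod_cast this
  have hN4 : (((2 * (2 * M) : ℕ) : ℝ)) = 4 * M := by push_cast; ring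
  have hN0 : 0 < (((2 * (2 * M) : ℕ) : ℝ)) := by rw [hN4]; positivity
  have hs₀pos : 0 < β * klE0 / (((2 * (2 * M) : ℕ) : ℝ)) := by positivity
  have hcol := colSum_scaleZero_of_frameOK (L := L) hK hβ hB₁ hB₂ hM2 hs₀pos Y
  refine mul_le_fourteen_sqrt_of_le hcol (by positivity) (by positivity) ?_
  rw [radicand_scaleZero_eq hN0.ne' hL.ne' hβ0.ne' hΛ.ne' (by linarith)]
  refine mul_le_mul_of_nonneg_left ?_ (by norm_num)
  have hB10 : 0 ≤ B₁ := (abs_nonneg _).trans (hB₁ 0)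
  have hB20 : 0 ≤ B₂ := (abs_nonneg _).trans (hB₂ 0)
  have h1 : 2 * β / (((2 * (2 * M) : ℕ) : ℝ)) + 12 / klE0 ≤ 1 / 2 + 12 / klE0 := by
    have : 2 * β / (((2 * (2 * M) : ℕ) : ℝ)) ≤ 1 / 2 := by rw [div_le_iff₀ hN0, hN4]; linarith
    linarith
  have hT3 : 256 * Real.pi ^ 5 * (4 * B₂ + 6 * B₁ + 2) ^ 2 / (β * klE0 ^ 2) ≤
      2 * Real.pi ^ 5 * (4 * B₂ + 6 * B₁ + 2) ^ 2 / klE0 ^ 2 := by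
    rw [div_le_div_iff₀ (by positivity) (by positivity)]
    have : 0 ≤ Real.pi ^ 5 * (4 * B₂ + 6 * B₁ + 2) ^ 2 * klE0 ^ 2 := by positivity
    nlinarith
  have hT4 : β ^ 5 * klE0 ^ 4 / (4 * Real.pi ^ 2 * (2 * M - 3) ^ 2) ≤ 1 := by
    have hM' : β ^ 3 ≤ 2 * (M : ℝ) - 3 := by linarith
    have h6 : (β ^ 3) ^ 2 ≤ (2 * (M : ℝ) - 3) ^ 2 := pow_le_pow_left₀ (by positivity) hM' 2
    have hπ2 : 9 ≤ Real.pi ^ 2 := by nlinarith [Real.pi_gt_three]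
    have hden : (0 : ℝ) < 4 * Real.pi ^ 2 * (2 * M - 3) ^ 2 := by
      have : (0 : ℝ) < 2 * M - 3 := by linarith
      positivity
    rw [div_le_one hden, show klE0 ^ 4 = (1 : ℝ) / 2 ^ 20 by norm_num [klE0]]
    have hβ5 : β ^ 5 ≤ (β ^ 3) ^ 2 := by
      rw [← pow_mul, show 3 * 2 = 5 + 1 from rfl, pow_succ]
      exact le_mul_of_one_le_right (by positivity) (by linarith)
    nlinarith [pow_pos hβ0 5]
  have hpos : 0 ≤ 2 / klE0 + 128 * Real.pi ^ 4 * (4 * B₂ + 6 * B₁ + 2) ^ 2 / klE0 +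
      256 * Real.pi ^ 5 * (4 * B₂ + 6 * B₁ + 2) ^ 2 / (β * klE0 ^ 2) + β ^ 5 * klE0 ^ 4 / (4 * Real.pi ^ 2 * (2 * M - 3) ^ 2) +
      Real.pi ^ 4 * ((7 : ℝ) ^ 2 * (4 * B₂ + 6 * B₁ + 2) * (2 / klE0) + 7 * (2 * B₁ + 1)) ^ 2 / klE0 ^ 3 := by
    have : (0 : ℝ) < 2 * M - 3 := by linarith
    positivity
  refine mul_le_mul h1 ?_ hpos (by positivity)
  linarith

/-- The tree's bound of the cutoff profile's first derivative: `|χ₂′| ≤ 32/3`. -/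
theorem klsv_B₁ : ∀ x, |deriv salmhoferCutoff x| ≤ 32 / 3 := klcd_abs_deriv_salmhoferCutoff_le_sharp

/-- The tree's bound of the cutoff profile's second derivative: `|χ₂″| ≤ 1110`. -/
theorem klsv_B₂ : ∀ x, |deriv (deriv salmhoferCutoff) x| ≤ 1110 := fun x => (klsd_abs_deriv2_salmhoferCutoff_lt x).le

/-- **Row sums at the named constant**: `Σ_Y ‖(SᵀC₀S) X Y‖ ≤ (N/β)·klScaleZeroA0`. -/
theorem rowSum_scaleZero_le_A0 [NeZero M] (hK : FrameOK R U Nsc μ K) (hβ : klBetaMin ≤ β) (hβM : β ^ 3 ≤ (M : ℝ))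
    (X : GridLeg (GridPoint L (2 * (2 * M)))) :
    ∑ Y : GridLeg (GridPoint L (2 * (2 * M))),
        ‖((hubbardGridSub L M β (2 * (2 * M))).transpose * hubbardCovAboveCT L M β μ 0 K klE0 *
            hubbardGridSub L M β (2 * (2 * M))) X Y‖ ≤ (((2 * (2 * M) : ℕ) : ℝ)) / β * klScaleZeroA0 := by
  have hβ0 : 0 < β := beta_pos_of_klBetaMin_le hβ
  have hN0 : 0 < (((2 * (2 * M) : ℕ) : ℝ)) := by have := NeZero.ne M; positivity
  have h := alpha_scaleZero_le (L := L) hK hβ klsv_B₁ klsv_B₂ hβM X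
  rw [show (14 : ℝ) * Real.sqrt _ = klScaleZeroA0 from rfl, div_mul_eq_mul_div, div_le_iff₀ hN0] at h
  rw [div_mul_eq_mul_div, le_div_iff₀ hβ0]
  linarith

/-- **Column sums at the named constant**: `Σ_X ‖(SᵀC₀S) X Y‖ ≤ (N/β)·klScaleZeroA0`. -/
theorem colSum_scaleZero_le_A0 [NeZero M] (hK : FrameOK R U Nsc μ K) (hβ : klBetaMin ≤ β) (hβM : β ^ 3 ≤ (M : ℝ))
    (Y : GridLeg (GridPoint L (2 * (2 * M)))) :
    ∑ X : GridLeg (GridPoint L (2 * (2 * M))),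
        ‖((hubbardGridSub L M β (2 * (2 * M))).transpose * hubbardCovAboveCT L M β μ 0 K klE0 *
            hubbardGridSub L M β (2 * (2 * M))) X Y‖ ≤ (((2 * (2 * M) : ℕ) : ℝ)) / β * klScaleZeroA0 := by
  have hβ0 : 0 < β := beta_pos_of_klBetaMin_le hβ
  have hN0 : 0 < (((2 * (2 * M) : ℕ) : ℝ)) := by have := NeZero.ne M; positivity
  have h := alpha_scaleZero_col_le (L := L) hK hβ klsv_B₁ klsv_B₂ hβM Y
  rw [show (14 : ℝ) * Real.sqrt _ = klScaleZeroA0 from rfl, div_mul_eq_mul_div, div_le_iff₀ hN0] at h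
  rw [div_mul_eq_mul_div, le_div_iff₀ hβ0]
  linarith

end Alpha

/-! ## §2 The explicit values bound -/

section Values

variable {L M : ℕ} [NeZero L]

/-- **The scale-`0` pair amplitude is `U + O(U²)`, EXPLICIT**: for every admissible frame (`FrameOK R U N μ K`, `R.WF`), `0 < U ≤ 1`,
`klBetaMin ≤ β ≤ L`, `β³ ≤ M`, and under the package smallness `klScaleZeroThetaC R · U ≤ 1/2`, for EVERY total momentum `Qm` and all `k, k′`:
`‖klPairAmplitude … 0 Qm k k′ − U‖ ≤ klScaleZeroValC R · U²`. -/
theorem norm_klPairAmplitude_zero_sub_le_sq [NeZero M] {R : RenConsts} (hR : R.WF) {U : ℝ} (hU : 0 < U) (hU1 : U ≤ 1)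
    {Nsc : ℕ} {μ : ℝ} {K : TrigPolyC4v} (hK : FrameOK R U Nsc μ K) {β : ℝ} (hβ : klBetaMin ≤ β) (hβL : β ≤ L)
    (hβM : β ^ 3 ≤ (M : ℝ)) (hθ : klScaleZeroThetaC R * U ≤ 1 / 2) (Qm k k' : TorusSite 2 L) :
    ‖klPairAmplitude L M β U μ K 0 Qm k k' - (U : ℂ)‖ ≤ klScaleZeroValC R * U ^ 2 := by
  -- notation and signs
  set Ng : ℕ := 2 * (2 * M) with hNg
  haveI : NeZero Ng := ⟨by rw [hNg]; have := NeZero.ne M; omega⟩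
  have hβ0 : 0 < β := beta_pos_of_klBetaMin_le hβ
  have hN0 : 0 < ((Ng : ℕ) : ℝ) := by exact_mod_cast Nat.pos_of_ne_zero (NeZero.ne Ng)
  have hUabs : |U| = U := abs_of_pos hU
  have hU1' : |U| ≤ 1 := by rwa [hUabs]
  have hG0 : 0 ≤ R.Gfr 0 := hR.2.2 0
  set κ₀ : ℝ := Real.sqrt (2 * (7 + 6047)) with hκ₀
  have hκ : 0 < κ₀ := Real.sqrt_pos.2 (by norm_num)
  have hA0 := klScaleZeroA0_pos
  have hCV := klScaleZeroCV_pos hG0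
  -- the decay constant
  set α : ℝ := ((Ng : ℕ) : ℝ) / β * klScaleZeroA0 with hα
  have hαpos : 0 < α := by positivity
  have hrow := fun X => rowSum_scaleZero_le_A0 (L := L) (μ := μ) hK hβ hβM X
  have hcol := fun Y => colSum_scaleZero_le_A0 (L := L) (μ := μ) hK hβ hβM Y
  -- the degree-2 size
  set kK : ℝ := klKappaFrameC R * |U| with hkK
  have hkKframe : ∑ z : TorusSite 2 L, ‖framePosKernel L K z‖ ≤ kK :=
    sum_norm_framePosKernel_le_linear_of_frameOK hR hU.ne' hU1' hK
  set N₁ : ℝ := |β| / Ng * kK with hN₁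
  have hkK0 : 0 ≤ kK := by rw [hkK]; exact mul_nonneg (klKappaFrameC_pos hG0).le (abs_nonneg U)
  have hN₁0 : 0 ≤ N₁ := by positivity
  have hct : ∀ (j : Fin 2) (w : GridLeg (GridPoint L Ng)),
      ∑ Y ∈ univ.filter (fun Y : Fin 2 → GridLeg (GridPoint L Ng) => Y j = w),
        ‖kernel ℂ (hubbardGridCounterQuadratic L Ng β K) 2 Y‖ ≤ N₁ := fun j w =>
    (sum_norm_kernel_hubbardGridCounterQuadratic_le_l1 β K j w).trans (mul_le_mul_of_nonneg_left hkKframe (by positivity))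
  -- the field-weighted norm and the smallness
  set V : ℝ := normV (GridLeg (GridPoint L Ng)) κ₀ κ₀
    (fun m' : ℕ => if m' = 1 then N₁ else if m' = 2 then |U| * |β| / (Ng : ℕ) else 0) with hV
  have hVeq : V = (Real.exp 2 * (κ₀ + κ₀)) ^ 2 * (|β| / Ng * kK) + (Real.exp 2 * (κ₀ + κ₀)) ^ 4 * (|U| * |β| / Ng) := by
    rw [hV, hN₁]
    exact normV_scaleZeroPinnedL1_eq four_le_card_gridLeg κ₀ κ₀ β U kK Ng
  have hNV : ((Ng : ℕ) : ℝ) / β * V ≤ klScaleZeroCV R * U := by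
    rw [hVeq, abs_of_pos hβ0, hkK, hUabs, klScaleZeroCV, ← hκ₀, show κ₀ + κ₀ = 2 * κ₀ by ring]
    have h2 : 0 ≤ (Real.exp 2 * (2 * κ₀)) ^ 2 := sq_nonneg _
    have h4 : 0 ≤ (Real.exp 2 * (2 * κ₀)) ^ 4 := by positivity
    have hKC : 0 ≤ klKappaFrameC R := (klKappaFrameC_pos hG0).le
    refine le_of_eq ?_
    field_simp
  have hV0 : 0 ≤ V := by
    rw [hV]; exact normV_nonneg hκ.le hκ.le (klsv_profile_nonneg β U Ng hN₁0)
  set θ : ℝ := Real.exp 1 * α * V / κ₀ ^ 2 with hθdef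
  have hθle : θ ≤ klScaleZeroThetaC R * U := by
    have h1 : θ = Real.exp 1 * klScaleZeroA0 * (((Ng : ℕ) : ℝ) / β * V) / κ₀ ^ 2 := by rw [hθdef, hα]; ring
    rw [h1, klScaleZeroThetaC, ← hκ₀]
    have : Real.exp 1 * klScaleZeroA0 * (((Ng : ℕ) : ℝ) / β * V) ≤ Real.exp 1 * klScaleZeroA0 * (klScaleZeroCV R * U) :=
      mul_le_mul_of_nonneg_left hNV (by positivity)
    calc Real.exp 1 * klScaleZeroA0 * (((Ng : ℕ) : ℝ) / β * V) / κ₀ ^ 2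
        ≤ Real.exp 1 * klScaleZeroA0 * (klScaleZeroCV R * U) / κ₀ ^ 2 := div_le_div_of_nonneg_right this (by positivity)
      _ = _ := by ring
  have hθhalf : θ ≤ 1 / 2 := hθle.trans hθ
  have hθ0 : 0 ≤ θ := by positivity
  have hθ1 : θ < 1 := by linarith
  -- the parametric bound
  have hmain := norm_klPairAmplitude_zero_sub_le_of_frameOK (L := L) (M := M) hK hβ hβL hαpos hrow hcol hN₁0 hct
    (by rw [← hκ₀]; exact hθ1) Qm k k'
  rw [← hκ₀] at hmain
  refine hmain.trans ?_
  -- `96·(N/β)·(κ₀⁻⁴·eV·θ/(1−θ)) ≤ 96κ₀⁻⁴·e·(CV·U)·(2·ThetaC·U) = ValC·U²`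
  change 96 * ((Ng : ℕ) : ℝ) / β * (κ₀⁻¹ ^ 4 * (Real.exp 1 * V) * θ / (1 - θ)) ≤ klScaleZeroValC R * U ^ 2
  have hfrac : θ / (1 - θ) ≤ 2 * (klScaleZeroThetaC R * U) := by
    rw [div_le_iff₀ (by linarith)]
    nlinarith [mul_nonneg hθ0 (by linarith : (0:ℝ) ≤ klScaleZeroThetaC R * U)]
  have hκ4 : 0 ≤ κ₀⁻¹ ^ 4 := by positivity
  calc 96 * ((Ng : ℕ) : ℝ) / β * (κ₀⁻¹ ^ 4 * (Real.exp 1 * V) * θ / (1 - θ))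
      = 96 * κ₀⁻¹ ^ 4 * (Real.exp 1 * (((Ng : ℕ) : ℝ) / β * V)) * (θ / (1 - θ)) := by ring
    _ ≤ 96 * κ₀⁻¹ ^ 4 * (Real.exp 1 * (klScaleZeroCV R * U)) * (2 * (klScaleZeroThetaC R * U)) := by
        refine mul_le_mul (mul_le_mul_of_nonneg_left (mul_le_mul_of_nonneg_left hNV (by positivity)) (by positivity)) hfrac
          (div_nonneg hθ0 (by linarith)) (by positivity)
    _ = klScaleZeroValC R * U ^ 2 := by rw [klScaleZeroValC_eq, ← hκ₀]; ring

/-! ## §3 The registered clause shapes -/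

/-- `0 ≤ initDevBar G U` for a well-formed `G`. -/
theorem initDevBar_nonneg_of_wf {G : GeoConsts} (hG : G.WF) (U : ℝ) : 0 ≤ initDevBar G U := by
  unfold initDevBar
  have h : 0 ≤ ∑ χ : D4Irrep, (G.abot χ + G.atop χ) := sum_nonneg fun χ _ => add_nonneg (hG.2.1 χ) (hG.1 χ)
  positivity

/-- `4·Q.CR·(Klam·U)² ≤ legDressBarQ G P Q U 0 4` (`0 ≤ Q.CR`, `0 ≤ Klam`). -/
theorem four_mul_CR_mul_sq_le_legDressBarQ (G : GeoConsts) {P : SplitConsts} {Q : EngConsts} (hK : 0 ≤ P.Klam) (hQ : 0 ≤ Q.CR) (U : ℝ) :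
    4 * Q.CR * (P.Klam * U) ^ 2 ≤ legDressBarQ G P Q U 0 4 := by
  unfold legDressBarQ
  rw [pow_zero, inv_one, mul_one]
  have h3 : 0 ≤ (P.Klam * |U|) ^ 3 := pow_nonneg (mul_nonneg hK (abs_nonneg U)) 3
  push_cast
  nlinarith [mul_nonneg hQ h3]

/-- **The pair-amplitude ultraviolet clause of `stub_engine_scale0`, explicit**: for any packages with `G.WF`, `0 ≤ P.Klam`, `0 ≤ Q.CR`,
every admissible frame, `0 < U ≤ 1`, `klBetaMin ≤ β ≤ L`, `β³ ≤ M`, the two NUMBER conditions `klScaleZeroThetaC R·U ≤ 1/2` and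
`klScaleZeroValC R ≤ 4·Q.CR·P.Klam²` give `PairLadderStepAtV8 … 0 ∧ QuarticValueUVAtS2 … 0`. -/
theorem pairLadderStepAtV8_zero_of_frameOK_explicit [NeZero M] {G : GeoConsts} (hG : G.WF) {P : SplitConsts} (hP : 0 ≤ P.Klam)
    {Q : EngConsts} (hQ : 0 ≤ Q.CR) {R : RenConsts} (hR : R.WF) {U : ℝ} (hU : 0 < U) (hU1 : U ≤ 1)
    {Nsc : ℕ} {μ : ℝ} {K : TrigPolyC4v} (hK : FrameOK R U Nsc μ K) {β : ℝ} (hβ : klBetaMin ≤ β) (hβL : β ≤ L)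
    (hβM : β ^ 3 ≤ (M : ℝ)) (hθ : klScaleZeroThetaC R * U ≤ 1 / 2) (hcmp : klScaleZeroValC R ≤ 4 * Q.CR * P.Klam ^ 2) :
    PairLadderStepAtV8 L M G P Q β U μ K 0 ∧ QuarticValueUVAtS2 L M G P Q β U μ K 0 := by
  have hUV : ∀ Qm : TorusSite 2 L, ∀ k ∈ klBall L μ K, ∀ k' ∈ klBall L μ K,
      ‖klPairAmplitude L M β U μ K 0 Qm k k' - (U : ℂ)‖ ≤ initDevBar G U + legDressBarQ G P Q U 0 4 := by
    intro Qm k _ k' _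
    refine (norm_klPairAmplitude_zero_sub_le_sq hR hU hU1 hK hβ hβL hβM hθ Qm k k').trans ?_
    have h1 : klScaleZeroValC R * U ^ 2 ≤ 4 * Q.CR * (P.Klam * U) ^ 2 := by
      rw [show 4 * Q.CR * (P.Klam * U) ^ 2 = (4 * Q.CR * P.Klam ^ 2) * U ^ 2 by ring]
      exact mul_le_mul_of_nonneg_right hcmp (sq_nonneg U)
    linarith [four_mul_CR_mul_sq_le_legDressBarQ G hP hQ U, initDevBar_nonneg_of_wf hG U]
  have hE2 : PairLadderStepAtV8 L M G P Q β U μ K 0 := ⟨fun _ => hUV, fun h1 => absurd h1 (by omega)⟩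
  exact ⟨hE2, klvr_quarticValueUVAtS2_of_pairLadderStepAtV8 hE2⟩

/-- **The same under the ENGINE's binders** (`klEngL₃ β U ≤ L`, `klEngM₃ β U L ≤ M`): what `stub_engine_scale0`'s assembler applies, leaving
the two package conditions `klScaleZeroThetaC R·U ≤ 1/2` (a `U₀`-threshold) and `klScaleZeroValC R ≤ 4·Q.CR·P.Klam²` (a `Q`-slack). -/
theorem pairLadderStepAtV8_zero_of_klEng [NeZero M] {G : GeoConsts} (hG : G.WF) {P : SplitConsts} (hP : P.WF)
    {Q : EngConsts} (hQ : Q.WF) {R : RenConsts} (hR : R.WF) {U : ℝ} (hU : 0 < U) (hU1 : U ≤ 1)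
    {μ : ℝ} {K : TrigPolyC4v} {β : ℝ} (hβ : klBetaMin ≤ β) (hK : FrameOK R U (nScales β) μ K)
    (hL : klEngL₃ β U ≤ L) (hM : klEngM₃ β U L ≤ M)
    (hθ : klScaleZeroThetaC R * U ≤ 1 / 2) (hcmp : klScaleZeroValC R ≤ 4 * Q.CR * P.Klam ^ 2) :
    PairLadderStepAtV8 L M G P Q β U μ K 0 ∧ QuarticValueUVAtS2 L M G P Q β U μ K 0 :=
  pairLadderStepAtV8_zero_of_frameOK_explicit hG (by linarith [hP.1]) hQ.2.1 hR hU hU1 hK hβ (le_of_klEngL₃_le hL)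
    (pow_three_le_of_klEng hβ hL hM) hθ hcmp

end Values

end Summit.HubbardSuperconductivity.HubbardSuperconductivity.Theorems.EngineV8

end
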